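import Summits.Schanuel.Schanuel.Theorems.ZilberEacParamCurveCase
import Summits.Schanuel.Schanuel.Theorems.ZilberEacGraphCurveInstances
import Summits.Schanuel.Schanuel.Theorems.ZilberEacFibrationProj
import HarnessLib

/-!
# Polynomially parametrised base curves, VIII: examples (cusp, node, non-real equal degrees) and
# members of `EC(3,2)` fibred over `C × Z(P)`

HONEST FRAMING.  Cell `pub-schanuel` (Zilber's Exponential-Algebraic Closedness, case ladder;
host summit Schanuel), seat 2, gen 19.  Examples for the density theorems of
`ZilberEacParamCurveDensity` / `ZilberEacParamCurveCase` (Mantova–Masser's OPEN density question,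
PLMS 2024 §1 p. 5, on product surfaces over a polynomial curve `C = g(ℂ)`), and the consequence on
the rung.  NOT Schanuel's conjecture (neither used nor implied; EAC ⇏ SC); `EC(3,2)` stays OPEN;
the question stays OPEN in general.

* Part C: the CUSP `x₀³ = x₁²` (`g = (t², t³)`) × the circle `y₀² + y₁² = 2` — case ∧ dense, also
  in plain coordinates (`cusp_eq_paramCurve`: `{x₀³ = x₁²} = {(t², t³)}`); the NODAL cubic
  `x₁² = x₀²(x₀ + 1)` (`g = (t² - 1, t³ - t)`) × the circle; equal degrees with non-real leading
  ratio `g = (t², i t² + t)` (the curve `(x₁ - i x₀)² = x₀`) × the circle.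
* Part D: by the fibration principle (THEOREM F′, `inter_expGraph_nonempty_of_unprojectedDense_proj`)
  irreducible threefolds of `ℂ³ × ℂ³` fibred in curves over such a surface meet `Γ_exp` — new
  unconditional members of the open cell `EC(3,2)`.
-/

noncomputable section

open Complex MvPolynomial
open Literature.NumberTheory.Transcendental Literature.ModelTheory.Zilber
open Literature.ModelTheory.ExponentialFields

set_option linter.dupNamespace false

namespace Summit.Schanuel.Schanuel.Theorems

/-! ## Part C. Examples: the cusp, the node, a curve with non-real leading ratio -/

section Examples

/-- The cuspidal cubic is the polynomial curve `t ↦ (t², t³)`: `{x₀³ = x₁²} = {(t², t³)}`. -/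
theorem cusp_eq_paramCurve :
    {x : Fin 2 → ℂ | x 0 ^ 3 = x 1 ^ 2} =
      {x : Fin 2 → ℂ | ∃ t : ℂ, x 0 = (Polynomial.X ^ 2 : Polynomial ℂ).eval t ∧
        x 1 = (Polynomial.X ^ 3 : Polynomial ℂ).eval t} := by
  ext x
  simp only [Set.mem_setOf_eq, Polynomial.eval_pow, Polynomial.eval_X]
  constructor
  · intro h
    by_cases h0 : x 0 = 0
    · have h1 : x 1 = 0 := by
        have : x 1 ^ 2 = 0 := by rw [← h, h0]; ring
        exact pow_eq_zero_iff (by norm_num) |>.1 this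
      exact ⟨0, by simp [h0], by simp [h1]⟩
    · refine ⟨x 1 / x 0, ?_, ?_⟩
      · field_simp
        linear_combination h
      · have h1 : x 1 ≠ 0 := by
          intro h1; apply h0
          have : x 0 ^ 3 = 0 := by rw [h, h1]; ring
          exact pow_eq_zero_iff (by norm_num) |>.1 this
        field_simp
        linear_combination h
  · rintro ⟨t, h0, h1⟩
    rw [h0, h1]; ring

/-- **The cusp × the circle.**  `S = {x₀³ = x₁²} × {y₀² + y₁² = 2} ⊆ ℂ² × ℂ²` (base `t ↦ (t², t³)`,
NOT a graph over either additive coordinate axis) is in Mantova–Masser's case (dim-π-S-1-free) and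
its exponential points `(t², t³, e^{t²}, e^{t³})`, `e^{2t²} + e^{2t³} = 2`, are Zariski dense.
[cite: MantovaMasser2023, §1 Further remarks, p. 5 (the question, open in general)] (new) -/
theorem unprojectedDensityQuestion_instance_cusp_circle :
    MMCaseDimPiOneFree {w : Fin 2 ⊕ Fin 2 → ℂ | ∃ t : ℂ,
        w (Sum.inl 0) = (Polynomial.X ^ 2 : Polynomial ℂ).eval t ∧
        w (Sum.inl 1) = (Polynomial.X ^ 3 : Polynomial ℂ).eval t ∧
        MvPolynomial.eval (fun i => w (Sum.inr i))
          (X 0 ^ 2 + X 1 ^ 2 - MvPolynomial.C 2 : MvPolynomial (Fin 2) ℂ) = 0} ∧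
      UnprojectedDense {w : Fin 2 ⊕ Fin 2 → ℂ | ∃ t : ℂ,
        w (Sum.inl 0) = (Polynomial.X ^ 2 : Polynomial ℂ).eval t ∧
        w (Sum.inl 1) = (Polynomial.X ^ 3 : Polynomial ℂ).eval t ∧
        MvPolynomial.eval (fun i => w (Sum.inr i))
          (X 0 ^ 2 + X 1 ^ 2 - MvPolynomial.C 2 : MvPolynomial (Fin 2) ℂ) = 0} :=
  unprojectedDensityQuestion_instance_paramSurface_of_lt (Polynomial.X ^ 2) (Polynomial.X ^ 3)
    (by simp) (by simp) (irreducible_circlePoly two_ne_zero) (circlePoly_support_pair two_ne_zero)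

/-- **The cusp × the circle, plain coordinates**: the exponential points of
`{w | x₀³ = x₁², y₀² + y₁² = 2}` are Zariski dense. (new) -/
theorem unprojectedDense_cusp_circle :
    UnprojectedDense {w : Fin 2 ⊕ Fin 2 → ℂ | w (Sum.inl 0) ^ 3 = w (Sum.inl 1) ^ 2 ∧
      w (Sum.inr 0) ^ 2 + w (Sum.inr 1) ^ 2 = 2} := by
  have h := unprojectedDensityQuestion_instance_cusp_circle.2
  have e : {w : Fin 2 ⊕ Fin 2 → ℂ | w (Sum.inl 0) ^ 3 = w (Sum.inl 1) ^ 2 ∧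
      w (Sum.inr 0) ^ 2 + w (Sum.inr 1) ^ 2 = 2} =
      {w : Fin 2 ⊕ Fin 2 → ℂ | ∃ t : ℂ,
        w (Sum.inl 0) = (Polynomial.X ^ 2 : Polynomial ℂ).eval t ∧
        w (Sum.inl 1) = (Polynomial.X ^ 3 : Polynomial ℂ).eval t ∧
        MvPolynomial.eval (fun i => w (Sum.inr i))
          (X 0 ^ 2 + X 1 ^ 2 - MvPolynomial.C 2 : MvPolynomial (Fin 2) ℂ) = 0} := by
    ext w
    have hc : (projAdd w) ∈ {x : Fin 2 → ℂ | x 0 ^ 3 = x 1 ^ 2} ↔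
        (projAdd w) ∈ {x : Fin 2 → ℂ | ∃ t : ℂ, x 0 = (Polynomial.X ^ 2 : Polynomial ℂ).eval t ∧
          x 1 = (Polynomial.X ^ 3 : Polynomial ℂ).eval t} := by rw [cusp_eq_paramCurve]
    simp only [Set.mem_setOf_eq, projAdd_apply] at hc
    simp only [Set.mem_setOf_eq, map_sub, map_add, map_pow, MvPolynomial.eval_X, MvPolynomial.eval_C,
      sub_eq_zero]
    constructor
    · rintro ⟨h1, h2⟩
      obtain ⟨t, ht0, ht1⟩ := hc.1 h1
      exact ⟨t, ht0, ht1, h2⟩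
    · rintro ⟨t, ht0, ht1, h2⟩
      exact ⟨hc.2 ⟨t, ht0, ht1⟩, h2⟩
  rw [e]; exact h

/-- The nodal cubic is the polynomial curve `t ↦ (t² - 1, t³ - t)`: `{x₁² = x₀²(x₀ + 1)} =
{(t² - 1, t³ - t)}`. -/
theorem node_eq_paramCurve :
    {x : Fin 2 → ℂ | x 1 ^ 2 = x 0 ^ 2 * (x 0 + 1)} =
      {x : Fin 2 → ℂ | ∃ t : ℂ, x 0 = (Polynomial.X ^ 2 - 1 : Polynomial ℂ).eval t ∧
        x 1 = (Polynomial.X ^ 3 - Polynomial.X : Polynomial ℂ).eval t} := by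
  ext x
  simp only [Set.mem_setOf_eq, Polynomial.eval_pow, Polynomial.eval_X, Polynomial.eval_sub,
    Polynomial.eval_one]
  constructor
  · intro h
    by_cases h0 : x 0 = 0
    · have h1 : x 1 = 0 := by
        have : x 1 ^ 2 = 0 := by rw [h, h0]; ring
        exact pow_eq_zero_iff (by norm_num) |>.1 this
      exact ⟨1, by simp [h0], by simp [h1]⟩
    · refine ⟨x 1 / x 0, ?_, ?_⟩
      · field_simp
        linear_combination -h
      · field_simp
        linear_combination -(x 1) * h
  · rintro ⟨t, h0, h1⟩
    rw [h0, h1]; ring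

/-- **The node × the circle.**  `S = {x₁² = x₀²(x₀ + 1)} × {y₀² + y₁² = 2}` is in Mantova–Masser's
case and its exponential points are Zariski dense.
[cite: MantovaMasser2023, §1 Further remarks, p. 5 (the question, open in general)] (new) -/
theorem unprojectedDensityQuestion_instance_node_circle :
    MMCaseDimPiOneFree {w : Fin 2 ⊕ Fin 2 → ℂ | ∃ t : ℂ,
        w (Sum.inl 0) = (Polynomial.X ^ 2 - 1 : Polynomial ℂ).eval t ∧
        w (Sum.inl 1) = (Polynomial.X ^ 3 - Polynomial.X : Polynomial ℂ).eval t ∧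
        MvPolynomial.eval (fun i => w (Sum.inr i))
          (X 0 ^ 2 + X 1 ^ 2 - MvPolynomial.C 2 : MvPolynomial (Fin 2) ℂ) = 0} ∧
      UnprojectedDense {w : Fin 2 ⊕ Fin 2 → ℂ | ∃ t : ℂ,
        w (Sum.inl 0) = (Polynomial.X ^ 2 - 1 : Polynomial ℂ).eval t ∧
        w (Sum.inl 1) = (Polynomial.X ^ 3 - Polynomial.X : Polynomial ℂ).eval t ∧
        MvPolynomial.eval (fun i => w (Sum.inr i))
          (X 0 ^ 2 + X 1 ^ 2 - MvPolynomial.C 2 : MvPolynomial (Fin 2) ℂ) = 0} := by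
  have hd0 : (Polynomial.X ^ 2 - 1 : Polynomial ℂ).natDegree = 2 := by
    rw [show (Polynomial.X ^ 2 - 1 : Polynomial ℂ) = Polynomial.X ^ 2 - Polynomial.C 1 by simp]
    exact Polynomial.natDegree_X_pow_sub_C
  have hd1 : (Polynomial.X ^ 3 - Polynomial.X : Polynomial ℂ).natDegree = 3 := by
    rw [Polynomial.natDegree_sub_eq_left_of_natDegree_lt] <;> simp
  exact unprojectedDensityQuestion_instance_paramSurface_of_lt (Polynomial.X ^ 2 - 1)
    (Polynomial.X ^ 3 - Polynomial.X) (by rw [hd0]; norm_num) (by rw [hd0, hd1]; norm_num)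
    (irreducible_circlePoly two_ne_zero) (circlePoly_support_pair two_ne_zero)

/-- **The node × the circle, plain coordinates.** (new) -/
theorem unprojectedDense_node_circle :
    UnprojectedDense {w : Fin 2 ⊕ Fin 2 → ℂ | w (Sum.inl 1) ^ 2 = w (Sum.inl 0) ^ 2 * (w (Sum.inl 0) + 1) ∧
      w (Sum.inr 0) ^ 2 + w (Sum.inr 1) ^ 2 = 2} := by
  have h := unprojectedDensityQuestion_instance_node_circle.2
  have e : {w : Fin 2 ⊕ Fin 2 → ℂ | w (Sum.inl 1) ^ 2 = w (Sum.inl 0) ^ 2 * (w (Sum.inl 0) + 1) ∧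
      w (Sum.inr 0) ^ 2 + w (Sum.inr 1) ^ 2 = 2} =
      {w : Fin 2 ⊕ Fin 2 → ℂ | ∃ t : ℂ,
        w (Sum.inl 0) = (Polynomial.X ^ 2 - 1 : Polynomial ℂ).eval t ∧
        w (Sum.inl 1) = (Polynomial.X ^ 3 - Polynomial.X : Polynomial ℂ).eval t ∧
        MvPolynomial.eval (fun i => w (Sum.inr i))
          (X 0 ^ 2 + X 1 ^ 2 - MvPolynomial.C 2 : MvPolynomial (Fin 2) ℂ) = 0} := by
    ext w
    have hc : (projAdd w) ∈ {x : Fin 2 → ℂ | x 1 ^ 2 = x 0 ^ 2 * (x 0 + 1)} ↔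
        (projAdd w) ∈ {x : Fin 2 → ℂ | ∃ t : ℂ, x 0 = (Polynomial.X ^ 2 - 1 : Polynomial ℂ).eval t ∧
          x 1 = (Polynomial.X ^ 3 - Polynomial.X : Polynomial ℂ).eval t} := by rw [node_eq_paramCurve]
    simp only [Set.mem_setOf_eq, projAdd_apply] at hc
    simp only [Set.mem_setOf_eq, map_sub, map_add, map_pow, MvPolynomial.eval_X, MvPolynomial.eval_C,
      sub_eq_zero]
    constructor
    · rintro ⟨h1, h2⟩
      obtain ⟨t, ht0, ht1⟩ := hc.1 h1
      exact ⟨t, ht0, ht1, h2⟩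
    · rintro ⟨t, ht0, ht1, h2⟩
      exact ⟨hc.2 ⟨t, ht0, ht1⟩, h2⟩
  rw [e]; exact h

/-- **Equal degrees with non-real leading ratio × the circle.**  Base `t ↦ (t², i t² + t)` (the
curve `(x₁ - i x₀)² = x₀`, asymptotic to the line of NON-REAL slope `i`): case ∧ dense.
[cite: MantovaMasser2023, §1 Further remarks, p. 5 (the question, open in general)] (new) -/
theorem unprojectedDensityQuestion_instance_iQuadratic_circle :
    MMCaseDimPiOneFree {w : Fin 2 ⊕ Fin 2 → ℂ | ∃ t : ℂ,
        w (Sum.inl 0) = (Polynomial.X ^ 2 : Polynomial ℂ).eval t ∧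
        w (Sum.inl 1) = (Polynomial.C I * Polynomial.X ^ 2 + Polynomial.X : Polynomial ℂ).eval t ∧
        MvPolynomial.eval (fun i => w (Sum.inr i))
          (X 0 ^ 2 + X 1 ^ 2 - MvPolynomial.C 2 : MvPolynomial (Fin 2) ℂ) = 0} ∧
      UnprojectedDense {w : Fin 2 ⊕ Fin 2 → ℂ | ∃ t : ℂ,
        w (Sum.inl 0) = (Polynomial.X ^ 2 : Polynomial ℂ).eval t ∧
        w (Sum.inl 1) = (Polynomial.C I * Polynomial.X ^ 2 + Polynomial.X : Polynomial ℂ).eval t ∧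
        MvPolynomial.eval (fun i => w (Sum.inr i))
          (X 0 ^ 2 + X 1 ^ 2 - MvPolynomial.C 2 : MvPolynomial (Fin 2) ℂ) = 0} := by
  have hlt : (Polynomial.X : Polynomial ℂ).natDegree <
      (Polynomial.C I * Polynomial.X ^ 2 : Polynomial ℂ).natDegree := by
    rw [Polynomial.natDegree_C_mul_X_pow 2 I I_ne_zero, Polynomial.natDegree_X]; norm_num
  have hd1 : (Polynomial.C I * Polynomial.X ^ 2 + Polynomial.X : Polynomial ℂ).natDegree = 2 := by
    rw [Polynomial.natDegree_add_eq_left_of_natDegree_lt hlt,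
      Polynomial.natDegree_C_mul_X_pow 2 I I_ne_zero]
  have hlc1 : (Polynomial.C I * Polynomial.X ^ 2 + Polynomial.X : Polynomial ℂ).leadingCoeff = I := by
    rw [Polynomial.leadingCoeff_add_of_degree_lt' (Polynomial.degree_lt_degree hlt),
      Polynomial.leadingCoeff_C_mul_X_pow]
  obtain ⟨v, hv, v', hv', hne⟩ := circlePoly_support_pair (r := 2) two_ne_zero
  refine unprojectedDensityQuestion_instance_paramSurface_of_eq (Polynomial.X ^ 2)
    (Polynomial.C I * Polynomial.X ^ 2 + Polynomial.X) (by simp) (by rw [hd1]; simp) ?_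
    (irreducible_circlePoly two_ne_zero) ⟨v, hv, v', hv', fun h => hne (by rw [h])⟩
  rw [hlc1]; simp

end Examples

/-! ## Part D. On the rung: threefolds fibred in curves over `C × Z(P)` meet `Γ_exp` -/

/-- **New members of `EC(3,2)` (polynomial-curve bases).**  An irreducible threefold `W ⊆ ℂ³ × ℂ³`
of dimension `3` meeting the torus, with `dim cl[Δ₂](W ∩ G³) = 2`, whose projected surface
`cl pr(W ∩ G³) ⊆ ℂ² × ℂ²` (forget `x₂, y₂`) is `C × Z(P)` (`C = g(ℂ)`, `1 ≤ deg g₀ < deg g₁`, `P`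
irreducible with two `y₁`-degrees), meets the graph of exponentiation (THEOREM F′; no rotundity or
freeness hypothesis). [cite: MantovaMasser2023, §1 Further remarks, p. 5] (new) -/
theorem inter_expGraph_nonempty_of_fibred_over_paramSurface (g₀ g₁ : Polynomial ℂ)
    (hg₀ : 1 ≤ g₀.natDegree) (hlt : g₀.natDegree < g₁.natDegree) {P : MvPolynomial (Fin 2) ℂ}
    (hirr : Irreducible P) (h2 : ∃ v ∈ P.support, ∃ v' ∈ P.support, v 1 ≠ v' 1)
    {W : Set (Fin (2 + 1) ⊕ Fin (2 + 1) → ℂ)}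
    (hW : IsIrreducibleClosed ℂ W) (hne : (W ∩ torusLocus ℂ (2 + 1)).Nonempty)
    (hdim : zariskiDim ℂ W = (2 + 1 : ℕ))
    (hfib : zariskiDim ℂ (matrixAct (dropLastMat 2) '' (W ∩ torusLocus ℂ (2 + 1))) = (2 : ℕ))
    (hV : zeroLocus ℂ (vanishingIdeal ℂ
      ((fun (w : Fin (2 + 1) ⊕ Fin (2 + 1) → ℂ) (t : Fin 2 ⊕ Fin 2) =>
        w (Sum.map Fin.castSucc Fin.castSucc t)) '' (W ∩ torusLocus ℂ (2 + 1)))) =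
      {w : Fin 2 ⊕ Fin 2 → ℂ | ∃ t : ℂ, w (Sum.inl 0) = g₀.eval t ∧ w (Sum.inl 1) = g₁.eval t ∧
        MvPolynomial.eval (fun i => w (Sum.inr i)) P = 0}) :
    (W ∩ expGraph ℂ (2 + 1)).Nonempty :=
  inter_expGraph_nonempty_of_unprojectedDense_proj hW hne hdim hfib
    (by rw [hV]; exact unprojectedDense_paramSurface_of_lt g₀ g₁ hg₀ hlt hirr h2)

end Summit.Schanuel.Schanuel.Theorems
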